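import Summits.HodgeConjecture.CorCM.Census.TwistScrewCover
import Summits.HodgeConjecture.CorCM.Census.TwistScrewShift
import Summits.HodgeConjecture.CorCM.Census.TwistScrewType
import Summits.HodgeConjecture.CorCM.Census.TwistGenerationExact

/-!
# Uniform twist generation, XV: THE SCREW LAW — `β − 2` rank-four faces generate when `2n ∣ ord t` for some `t ∈ B`; the COMPLETE LAW
# `μ_hodge(ℤ/2^{j+1} × B, (2^j, 0)) = β − 1 − [∃ t ∈ B, 2^{j+1} ∣ ord t]` for EVERY `j ≥ 1` and EVERY finite group `B` with `|B| ≥ 3`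

COR-CM (cell `pub-hodgecm2`), count-neutral kernel combinatorics by the binder seat b09 (gen 37; lane UNIFORM TWIST GENERATION, part XV — the
assembly of the screw half), on parts I–XIV and the treeʼs twist floor (`Census/CoinvariantTwistLaw.card_block_le_card_add_two`, b09 gen 33, through
part IX `sandwich_screw`) used BY NAME.  Theorems only: no definition, no `decide`, no certificate, no named fact, no `sorry`.
HONEST FRAMING: `HC_CM` is NOT proved, here or anywhere in the tree; nothing here is a period or a headline.

**MAIN THEOREM** (`exists_gfaces_generate_screw`).  Let `G` be a finite group with a datum `θ : G ≃ ℤ/2n × B` (`θ (PQ) = θ P + θ Q`, `θ c = (n, 0)`,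
`n ≥ 2`, `B` any finite group written additively) and let some `t ∈ B` have additive order divisible by `2n`.  Then there is a finite set
`S ⊆ gfaceSet G c` of rank-four face relations with

  `|S| + 2 ≤ β(G, c) = #Block c`   and   `hodgeSpan c ≤ ℤ⟨pairs⟩ + ℤ⟨all base changes of S⟩`,

so **`μ(G, c) ≤ β − 2`** — the SCREW SAVING, uniformly in `n` (kernel before: `n = 2`, `Census/QuarticTwistScrewLaw`, and `n = 4`,
`Census/OcticTwistScrewLaw`, each by a level-specific orientation machinery).

THE FAMILY.  The covering family of part XII — one potential-lowering face per block of potential `≥ 2`, toward the UPPER centre on upper-class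
blocks, and at the block of the SCREW TYPE `ψ` (part XIV) the one-row face `gface ψ θ⁻¹(x, 0) θ⁻¹(x, t)` — plus the `n − 1` transfer faces of
part VII at the profile type; NO equatorial square: `(β − n − 1) + (n − 1) = β − 2`.  THE PROOF (§1).  Star forms hold on the upper classes
(part XII (b)), hence on the near classes (part XI), so the transfer faces give the interior transfers (part VII `trans_zero_mem`); the three
corners of the one-row face lie in `upCl x` (part XIV), so `[ψ] ≡ θ_{cst x}[ψ]` modulo `L`; `L` is base-change stable and `ψ·Q⁻¹ = ψ` for
`Q = θ⁻¹(1, t)`, so also `[ψ] ≡ θ_{cst (x−1)}[ψ]` (part XIII `mapDomain_rt_thetaG`) — THE SCREW RELATION `θ_{cst x}[ψ] − θ_{cst (x−1)}[ψ] ∈ L`;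
the UNIFORM SHIFT IDENTITY (part XIII) turns it into `wplus (x − 1) ∈ L`, base change gives every upper star, and part Vʼs residual elimination
closes.

* §2 **THE EXACT LAW, SCREW CASE** (`exact_law_screw`, `n = 2^j`): `μ = β − 2` EXACTLY (the floor is part IXʼs `sandwich_screw`); and **THE
  COMPLETE LAW** (`complete_law`): for every `j ≥ 1` and every finite `B` with `|B| ≥ 3`, the least number of rank-four face relations whose base
  changes generate the integer Hodge lattice of `(ℤ/2^{j+1} × B, (2^j, 0))` modulo pairs is `β − 1 − [∃ t ∈ B, 2^{j+1} ∣ ord t]`, the floor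
  holding for every generating family of Hodge vectors — gen 32ʼs GRAND CONJECTURE for all abelian `(G, c)` in normal form (every abelian `G`
  with an involution `c` of height `2^j`, `j ≥ 1`, complement of order `≥ 3`); and in the coinvariant currency
  (`exists_gfaces_generate_card_eq_fibreTwo`): a generating family of EXACTLY `φ₂(G, c)` rank-four faces exists (`Census/CoinvariantFibre.fibreTwo`),
  and none of fewer Hodge vectors — **`μ(G, c) = φ₂(G, c)`**, the choice-free form of the law (twist fibre law `Census/CoinvariantTwistLaw` + floor
  `Census/CoinvariantFloor`).

## References
* [Pohlmann1968] H. Pohlmann, Algebraic cycles on abelian varieties of complex multiplication type, Ann. of Math. 88 (1968), Thm 1.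
* [Milne1999] J. S. Milne, Lefschetz motives and the Tate conjecture, Compositio Math. 117 (1999), Prop. 2.1, p. 54.
-/

namespace Summit.HodgeConjecture.CorCM.Census.TwistGeneration

open Finset
open Summit.HodgeConjecture.CorCM.Prior.AllgGroup.RfwfAllgGroup
open Summit.HodgeConjecture.CorCM.Census.BlockParity
open Summit.HodgeConjecture.CorCM.Census.Coinvariant
open Summit.HodgeConjecture.CorCM.Census.CoinvariantTwist

noncomputable section

variable {G : Type*} [Group G] [Fintype G] [DecidableEq G] {c : G}
variable {B : Type} [AddGroup B] [DecidableEq B] [Fintype B]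
variable {n : ℕ} [NeZero n] (θ : G ≃ ZMod (2 * n) × B)
variable (hθ : ∀ P Q : G, θ (P * Q) = θ P + θ Q) (hθc : θ c = (((n : ℕ) : ZMod (2 * n)), 0))

/-! ## §1 The screw law -/

omit [DecidableEq B] [NeZero n] in
/-- An element of additive order divisible by `2n ≥ 4` forces `|B| ≥ 3` (indeed `|B| ≥ 2n`). [folklore] -/
theorem three_le_card_of_dvd_addOrderOf (hn : 2 ≤ n) {t : B} (ht : 2 * n ∣ addOrderOf t) : 3 ≤ Fintype.card B := by
  have h1 := addOrderOf_le_card_univ (x := t)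
  have h2 := Nat.le_of_dvd (addOrderOf_pos t) ht
  omega

include θ hθ hθc in
/-- **MAIN THEOREM — THE UNIFORM SCREW LAW.**  Along a datum `θ : G ≃ ℤ/2n × B` (`n ≥ 2`) with some `t ∈ B` of additive order divisible by `2n`
there is a finite set `S` of rank-four face relations with `|S| + 2 ≤ β(G, c)` whose base changes generate the integer Hodge lattice modulo the
pairs: `μ(G, c) ≤ β − 2`. [folklore] -/
theorem exists_gfaces_generate_screw (hc2 : c * c = 1) (hn : 2 ≤ n) (ht : ∃ t : B, 2 * n ∣ addOrderOf t) :
    ∃ S : Finset (CMF G c →₀ ℤ), (↑S ⊆ gfaceSet G c hc2) ∧ S.card + 2 ≤ Fintype.card (Block c) ∧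
      hodgeSpan c hc2 ≤ Submodule.span ℤ (pairSet c) ⊔ Submodule.span ℤ (translates c S) := by
  classical
  obtain ⟨t, ht⟩ := ht
  have hB : 3 ≤ Fintype.card B := three_le_card_of_dvd_addOrderOf hn ht
  have hcen := mul_comm_c θ hθ hθc
  -- the profile data: `|Q| = ⌊(|B| − 1)/2⌋`, `b₁ ≠ b₂ ∉ Q`
  obtain ⟨Q, -, hQ⟩ := Finset.exists_subset_card_eq (s := (univ : Finset B)) (n := (Fintype.card B - 1) / 2)
    (by rw [card_univ]; omega)
  have hQ1 : 2 * Q.card + 1 ≤ Fintype.card B := by rw [hQ]; omega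
  have hQ2 : Fintype.card B ≤ 2 * Q.card + 2 := by rw [hQ]; omega
  have hcompl : 1 < (univ \ Q).card := by rw [card_sdiff_of_subset (subset_univ _), card_univ]; omega
  obtain ⟨b₁, hb₁, b₂, hb₂, h12⟩ := Finset.one_lt_card.mp hcompl
  have hb₁Q : b₁ ∉ Q := (mem_sdiff.mp hb₁).2
  have hb₂Q : b₂ ∉ Q := (mem_sdiff.mp hb₂).2
  -- the screw data
  obtain ⟨ψ, Qt, x, p, q, hψQ, hQt1, hψ, hp, hq, hpq, hqp, hpx, hqx⟩ := exists_screw_data θ hθ hθc (c := c) hn ht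
  -- the family: the covering faces with the prescribed one-row face at `ψ`, and the `n − 1` transfer faces
  obtain ⟨S₀, hS₀, hcard₀, hcov⟩ := exists_cover_prescribed θ hθ hθc hc2 hψ hp hq hpq
  set F : ℕ → (CMF G c →₀ ℤ) := fun k => gface c hc2 (prof θ hθ hθc Q) (θ.symm ((k : ℕ), b₁)) (θ.symm (0, b₂)) with hF
  set S : Finset (CMF G c →₀ ℤ) := S₀ ∪ (Ico 1 n).image F with hS
  have hSsub : (↑S : Set (CMF G c →₀ ℤ)) ⊆ gfaceSet G c hc2 := by
    intro y hy
    rcases mem_union.mp (mem_coe.mp hy) with h | h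
    · exact hS₀ h
    · obtain ⟨k, -, rfl⟩ := mem_image.mp h
      exact ⟨_, _, _, symm_not_mem_orb θ hθ hθc h12 _ 0, rfl⟩
  refine ⟨S, hSsub, ?_, ?_⟩
  · -- the count: `(β − n − 1) + (n − 1) + 2 ≤ β`
    have h1 : S.card ≤ S₀.card + ((Ico 1 n).image F).card := card_union_le _ _
    have h2 : ((Ico 1 n).image F).card ≤ n - 1 := card_image_le.trans (by rw [Nat.card_Ico])
    have h3 := card_filter_add_le_card_block θ hθ hθc hc2 hB b₁
    omega
  · -- generation
    set L : Submodule ℤ (CMF G c →₀ ℤ) := Submodule.span ℤ (pairSet c) ⊔ Submodule.span ℤ (translates c S) with hL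
    have hmemS : ∀ s ∈ S, s ∈ L := fun s hs => Submodule.mem_sup_right (mem_span_translates_of_mem c S hs)
    have hL₀ : Submodule.span ℤ (translates c S₀) ≤ L := by
      refine le_sup_of_le_right (Submodule.span_mono ?_)
      rintro _ ⟨Q', s, hs, rfl⟩
      exact ⟨Q', s, mem_union_left _ hs, rfl⟩
    obtain ⟨hred, hstarUp, hFψ⟩ := hcov L hL₀
    have hstar : ∀ (a : ZMod (2 * n)) (Φ : CMF G c), Φ ∈ nearCl θ hθ hθc a →
        Finsupp.single Φ 1 - thetaG c hc2 (cst θ hθ hθc a) (typeSum G c (Finsupp.single Φ 1)) ∈ L :=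
      fun a Φ hΦ => hstarUp a Φ (near_subset_up θ hθ hθc hn hΦ)
    have hP : Submodule.span ℤ (pairSet c) ≤ L := le_sup_left
    have hLH : L ≤ hodgeSpan c hc2 := by
      refine sup_le (Submodule.span_le.mpr fun y hy => ?_) (Submodule.span_le.mpr fun y hy => ?_)
      · obtain ⟨Ψ, rfl⟩ := hy; exact pair_mem_hodgeSpan c hc2 Ψ
      · obtain ⟨Q', s, hs, rfl⟩ := hy
        obtain ⟨Φ, t₁, t₂, ht₂, rfl⟩ := hSsub hs
        refine gfaceSet_subset_hodgeSpan c hc2 ?_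
        rw [mapDomain_rt_gface]
        exact ⟨rt c Q' Φ, t₁ * Q'⁻¹, t₂ * Q'⁻¹, notMem_orb_mul_inv c Q' ht₂, rfl⟩
    -- the transfers, from the transfer faces
    have hT0 : ∀ k : ℕ, 1 ≤ k → k < n → trans θ hθ hθc hc2 0 ((k : ℕ) : ZMod (2 * n)) b₁ ∈ L := by
      intro k hk1 hk
      refine trans_zero_mem θ hθ hθc hc2 hn hB Q hQ1 hQ2 hb₁Q hb₂Q h12 hk1 hk L hstar (hmemS _ ?_)
      exact mem_union_right _ (mem_image_of_mem F (mem_Ico.mpr ⟨hk1, hk⟩))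
    have hT : ∀ (a y : ZMod (2 * n)) (b : B), 1 ≤ (y - a).val → (y - a).val < n → trans θ hθ hθc hc2 a y b ∈ L := by
      intro a y b h1 h2
      have h := mapDomain_rt_mem_psp c hcen (θ.symm (-a, -b + b₁)) S (hT0 _ h1 h2)
      rw [mapDomain_rt_trans, Equiv.apply_symm_apply] at h
      have eb : b₁ - (-b + b₁) = b := by rw [sub_eq_add_neg, neg_add_rev, neg_neg, add_neg_cancel_left]
      simp only [sub_neg_eq_add, zero_add, ZMod.natCast_zmod_val, sub_add_cancel, eb] at h
      exact h
    -- THE SCREW RELATION: `[ψ] ≡ θ_{cst x}[ψ]` and, translating by `Qt`, `[ψ] ≡ θ_{cst (x−1)}[ψ]`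
    obtain ⟨hc1, hc2', hc3⟩ := screw_corners_up θ hθ hθc hc2 hψ hp hq hpq hpx hqx
    have m0 : Finsupp.single ψ 1 - thetaG c hc2 (cst θ hθ hθc x) (typeSum G c (Finsupp.single ψ 1)) ∈ L :=
      single_sub_thetaG_mem_of_gface hc2 (cst θ hθ hθc x) ψ hqp L hFψ (hstarUp x _ hc1) (hstarUp x _ hc2') (hstarUp x _ hc3)
    have m1 : Finsupp.single ψ 1 - thetaG c hc2 (cst θ hθ hθc (x - 1)) (typeSum G c (Finsupp.single ψ 1)) ∈ L := by
      have h := mapDomain_rt_mem_psp c hcen Qt S m0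
      rwa [Finsupp.mapDomain_sub, Finsupp.mapDomain_single, mapDomain_rt_thetaG, hψQ, rt_cst, hQt1] at h
    -- the uniform shift identity at `x − 1` yields the upper star `wplus (x − 1)`
    have hWx : wplus θ hθ hθc hc2 (x - 1) ∈ L := by
      have hsh := thetaG_succ_sub_thetaG_add_wplus_mem θ hθ hθc hc2 L hP hT (x - 1) ψ
      rw [sub_add_cancel] at hsh
      have e : wplus θ hθ hθc hc2 (x - 1) =
          (thetaG c hc2 (cst θ hθ hθc x) (typeSum G c (Finsupp.single ψ 1))
            - thetaG c hc2 (cst θ hθ hθc (x - 1)) (typeSum G c (Finsupp.single ψ 1)) + wplus θ hθ hθc hc2 (x - 1))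
          + (Finsupp.single ψ 1 - thetaG c hc2 (cst θ hθ hθc x) (typeSum G c (Finsupp.single ψ 1)))
          - (Finsupp.single ψ 1 - thetaG c hc2 (cst θ hθ hθc (x - 1)) (typeSum G c (Finsupp.single ψ 1))) := by abel
      rw [e]
      exact Submodule.sub_mem _ (Submodule.add_mem _ hsh m0) m1
    have hW : ∀ a : ZMod (2 * n), wplus θ hθ hθc hc2 a ∈ L := by
      intro a
      have h := mapDomain_rt_mem_psp c hcen (θ.symm (x - 1 - a, 0)) S hWx
      rw [mapDomain_rt_wplus, Equiv.apply_symm_apply] at h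
      simp only [sub_sub_cancel] at h
      exact h
    -- descent + residual elimination
    intro y hy
    obtain ⟨y', hyy', hy'⟩ := hred y
    have hy'H : y' ∈ hodgeSpan c hc2 := by
      have e : y' = y - (y - y') := by abel
      rw [e]; exact Submodule.sub_mem _ hy (hLH hyy')
    have hres := residual_mem θ hθ hθc hc2 b₁ L hP hLH hT hW y' (exists_forall_typeSum_eq_of_mem_hodgeSpan c hc2 hcen hy'H) hy'
    have e : y = (y - y') + y' := by abel
    rw [e]
    exact Submodule.add_mem _ hyy' hres

include θ hθ hθc in
/-- **The face form**: the face relations themselves lie in `ℤ⟨pairs⟩ + ℤ⟨translates of S⟩` for a family with `|S| + 2 ≤ β` (the hypothesis shape of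
seat b09ʼs floors). [folklore] -/
theorem exists_gfaceSet_subset_screw (hc2 : c * c = 1) (hn : 2 ≤ n) (ht : ∃ t : B, 2 * n ∣ addOrderOf t) :
    ∃ S : Finset (CMF G c →₀ ℤ), (↑S ⊆ gfaceSet G c hc2) ∧ S.card + 2 ≤ Fintype.card (Block c) ∧
      gfaceSet G c hc2 ⊆ ↑(Submodule.span ℤ (pairSet c) ⊔ Submodule.span ℤ (translates c S)) := by
  obtain ⟨S, hS, hcard, hgen⟩ := exists_gfaces_generate_screw θ hθ hθc hc2 hn ht
  exact ⟨S, hS, hcard, fun y hy => hgen (gfaceSet_subset_hodgeSpan c hc2 hy)⟩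

/-! ## §2 The exact law in the screw case, and the complete law -/

include θ hθ hθc in
/-- **THE EXACT LAW, SCREW CASE.**  `n = 2^j ≥ 2`, some element of `B` of additive order divisible by `2n`: there is a family of rank-four face
relations with EXACTLY `β − 2` members whose base changes generate the Hodge lattice modulo pairs, and every finite family of integer Hodge vectors
whose base changes generate the face relations modulo pairs has at least `β − 2` members: **`μ(G, c) = β(G, c) − 2`**. [folklore] -/
theorem exact_law_screw (hc2 : c * c = 1) {j : ℕ} (hj : n = 2 ^ j) (hn : 2 ≤ n) (ht : ∃ t : B, 2 * n ∣ addOrderOf t) :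
    (∃ S : Finset (CMF G c →₀ ℤ), (↑S ⊆ gfaceSet G c hc2) ∧ S.card + 2 = Fintype.card (Block c) ∧
        hodgeSpan c hc2 ≤ Submodule.span ℤ (pairSet c) ⊔ Submodule.span ℤ (translates c S)) ∧
      (∀ S : Finset (CMF G c →₀ ℤ), (↑S : Set (CMF G c →₀ ℤ)) ⊆ hodgeSpan c hc2 →
        gfaceSet G c hc2 ⊆ ↑(Submodule.span ℤ (pairSet c) ⊔ Submodule.span ℤ (translates c S)) → Fintype.card (Block c) ≤ S.card + 2) := by
  obtain ⟨t, ht'⟩ := ht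
  have hB : 3 ≤ Fintype.card B := three_le_card_of_dvd_addOrderOf hn ht'
  obtain ⟨-, hfloor⟩ := sandwich_screw θ hθ hθc hc2 hj hn hB ⟨t, ht'⟩
  refine ⟨?_, hfloor⟩
  obtain ⟨S, hS, hcard, hgen⟩ := exists_gfaces_generate_screw θ hθ hθc hc2 hn ⟨t, ht'⟩
  have h := hfloor S (hS.trans (gfaceSet_subset_hodgeSpan c hc2)) fun y hy => hgen (gfaceSet_subset_hodgeSpan c hc2 hy)
  exact ⟨S, hS, by omega, hgen⟩

open Classical in
include θ hθ hθc in
/-- **THE COMPLETE LAW: `μ_hodge(ℤ/2^{j+1} × B, (2^j, 0)) = β − 1 − [∃ t ∈ B, 2^{j+1} ∣ ord t]` FOR EVERY `j ≥ 1` AND EVERY FINITE GROUP `B` OF ORDER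
`≥ 3`.**  Along a datum `θ : G ≃ ℤ/2n × B` with `n = 2^j ≥ 2` and `|B| ≥ 3`, put `δ = 2` if some element of `B` has additive order divisible by
`2n` and `δ = 1` otherwise: there is a family of rank-four face relations with exactly `β − δ` members whose base changes generate the integer
Hodge lattice modulo the pairs, and every finite family of integer Hodge vectors whose base changes generate the face relations modulo pairs has at
least `β − δ` members (parts IX and XV). [folklore] -/
theorem complete_law (hc2 : c * c = 1) {j : ℕ} (hj : n = 2 ^ j) (hn : 2 ≤ n) (hB : 3 ≤ Fintype.card B) :
    (∃ S : Finset (CMF G c →₀ ℤ), (↑S ⊆ gfaceSet G c hc2) ∧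
        S.card + (if ∃ t : B, 2 * n ∣ addOrderOf t then 2 else 1) = Fintype.card (Block c) ∧
        hodgeSpan c hc2 ≤ Submodule.span ℤ (pairSet c) ⊔ Submodule.span ℤ (translates c S)) ∧
      (∀ S : Finset (CMF G c →₀ ℤ), (↑S : Set (CMF G c →₀ ℤ)) ⊆ hodgeSpan c hc2 →
        gfaceSet G c hc2 ⊆ ↑(Submodule.span ℤ (pairSet c) ⊔ Submodule.span ℤ (translates c S)) →
          Fintype.card (Block c) ≤ S.card + (if ∃ t : B, 2 * n ∣ addOrderOf t then 2 else 1)) := by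
  by_cases ht : ∃ t : B, 2 * n ∣ addOrderOf t
  · simp only [if_pos ht]
    exact exact_law_screw θ hθ hθc hc2 hj hn ht
  · simp only [if_neg ht]
    exact exact_law_noScrew θ hθ hθc hc2 hj hn hB (fun b hb => ht ⟨b, hb⟩)

open Classical in
include θ hθ hθc in
/-- **`μ = φ₂`: THE GRAND CONJECTURE IN THE COINVARIANT CURRENCY.**  Along a datum `θ : G ≃ ℤ/2n × B` with `n = 2^j ≥ 2` and `|B| ≥ 3` there is a
family of rank-four face relations with EXACTLY `φ₂(G, c)` members (`Census/CoinvariantFibre.fibreTwo`, the dimension of the coinvariant fibre) whose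
base changes generate the integer Hodge lattice modulo the pairs — and by seat b09ʼs coinvariant floor (`Census/CoinvariantFloor.fibreTwo_le_card`) no
generating family of Hodge vectors has fewer: the least generating number is the choice-free invariant `φ₂(G, c)` (`= β − 1 − δ` by the twist fibre
law `Census/CoinvariantTwistLaw`). [folklore] -/
theorem exists_gfaces_generate_card_eq_fibreTwo (hc2 : c * c = 1) {j : ℕ} (hj : n = 2 ^ j) (hn : 2 ≤ n) (hB : 3 ≤ Fintype.card B) :
    (∃ S : Finset (CMF G c →₀ ℤ), (↑S ⊆ gfaceSet G c hc2) ∧ S.card = fibreTwo c hc2 ∧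
        hodgeSpan c hc2 ≤ Submodule.span ℤ (pairSet c) ⊔ Submodule.span ℤ (translates c S)) ∧
      (∀ S : Finset (CMF G c →₀ ℤ), (↑S : Set (CMF G c →₀ ℤ)) ⊆ hodgeSpan c hc2 →
        gfaceSet G c hc2 ⊆ ↑(Submodule.span ℤ (pairSet c) ⊔ Submodule.span ℤ (translates c S)) → fibreTwo c hc2 ≤ S.card) := by
  have hcen := mul_comm_c θ hθ hθc
  refine ⟨?_, fun S hS hX => fibreTwo_le_card c hc2 hcen S _ le_rfl hS hX⟩
  obtain ⟨⟨S, hS, hcard, hgen⟩, -⟩ := complete_law θ hθ hθc hc2 hj hn hB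
  refine ⟨S, hS, ?_, hgen⟩
  -- the twist fibre law through the bridge of part IX: `φ₂ + δ = β`
  have hcu := u_pow_n θ hθ hθc
  obtain ⟨Bs, hBs⟩ := exists_bSub θ hθ
  subst hj
  subst hcu
  have hord : orderOf (θ.symm (1, 0) : G) = 2 ^ (j + 1) := by rw [orderOf_u θ hθ, pow_succ, mul_comm]
  by_cases ht : ∃ t : B, 2 * 2 ^ j ∣ addOrderOf t
  · rw [if_pos ht] at hcard
    obtain ⟨t, ht'⟩ := ht
    have h := fibreTwo_add_two_eq_card_block (B := Bs) (u_comm θ hθ) hord (zpowers_u_disjoint θ hθ hBs) (exists_u_pow_mul θ hθ hBs) hc2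
      ⟨θ.symm (0, t), by rw [hBs, Equiv.apply_symm_apply], by
        rw [orderOf_eq_addOrderOf θ hθ (by rw [Equiv.apply_symm_apply]), Equiv.apply_symm_apply, pow_succ, mul_comm]; exact ht'⟩
    omega
  · rw [if_neg ht] at hcard
    have h := fibreTwo_add_one_eq_card_block (B := Bs) (u_comm θ hθ) hord (zpowers_u_disjoint θ hθ hBs) (exists_u_pow_mul θ hθ hBs) hc2
      (fun b hb h => ht ⟨(θ b).2, by rw [← orderOf_eq_addOrderOf θ hθ ((hBs b).mp hb)]; rw [pow_succ, mul_comm] at h; exact h⟩)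
    omega

end

end Summit.HodgeConjecture.CorCM.Census.TwistGeneration
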